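import Summits.QuantumAdvantage.QuantumAdvantage.Theorems.LinnikCubicClassGroupsDegreeOnePrimesEscapePolynomialFactorization
import Summits.QuantumAdvantage.QuantumAdvantage.Theorems.LinnikCubicClassGroupsDegreeOnePrimesEscapeNonsplitPrimeAnyField
import HarnessLib

/-!
# Every factorisation pattern of an integer polynomial modulo a good prime already occurs below
# `2·max(|d_K|^{L(n)}, |N f'(θ)|)`

Topic `Summits/QuantumAdvantage/QuantumAdvantage/Theorems`, cell B2b-1 (linnik-cubic), PART A (gen 26);
helper toward the crux `DegreeOnePrimesEscape` (stmt-QuantumAdvantage-11543) of route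
`LinnikCubicClassGroups`.  HONEST FRAMING: the value of this file is a THEOREM (kernel-checked, GRH-free,
unconditional) — NOT summit progress.

Closure-free, reference-prime form of `exists_prime_factorDegrees_eq_cycleType_le`
(`…PolynomialFactorization.lean`).  Let `θ ∈ 𝓞_K` generate the number field `K` of degree `n > 1`,
`f = minpoly ℤ θ`, `e_θ` the index exponent, `D_θ = N((f'(θ))) = |N_{K/ℚ} f'(θ)|`.  Call a prime GOOD
if `p ∤ d_K` and `p ∤ e_θ`, and call the multiset of degrees of the distinct monic irreducible factors
of `f mod p` the FACTORISATION PATTERN of `f` at `p`.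

* `not_dvd_discr_of_separating` — a prime unramified in `K` is unramified in a Galois closure `N`
  (`|d_N| ∣ ∏_ι |d_{ι K}|^{[N:ιK]}`, `natAbs_discr_dvd_prod_pow_of_isGalois`, Serre IV §1);
* `exists_galoisClosure_perm_unramified` — Galois-closure data `(N, ι, ψ)` as in
  `exists_galoisClosure_perm`, together with this transfer of unramifiedness;
* `exists_prime_factorDegrees_eq_of_prime` — **for `n > 1` there is `L = L(n)` such that for every
  `K`, `θ` as above and every good prime `ℓ` (however large), there is a good prime
  `p ≤ 2·max(|d_K|^L, D_θ)` at which `f` has the SAME factorisation pattern as at `ℓ`**: the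
  factorisation patterns of `f` modulo the good primes below `2·max(|d_K|^{L(n)}, D_θ)` exhaust all
  patterns that ever occur (Dedekind: the pattern at `ℓ` is the cycle type of `Frob_ℓ` on the roots;
  Chebotarev–Linnik in Bertrand intervals for that cycle type; Dedekind–Kummer back at `p`).
* `card_roots_toFinset_eq_count_one_splittingType`, `exists_prime_card_roots_lt_le_of_exponent_eq_one` —
  the number of distinct roots of `f mod p` is the multiplicity of `1` in the splitting type; X. Li's least
  non-split prime (`exists_nonsplitPrime_le_of_finrank`) in polynomial language for monogenic `𝓞_K = ℤ[θ]`: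
  a prime `p ≤ |d_K|^{L(n)}`, `p ∤ d_K`, modulo which `f` has fewer than `n` distinct roots;
* `exists_prime_splits_separable_le` — the `Splits ∧ Separable` form: `f mod p` is a product of DISTINCT
  LINEAR factors for some good prime `p ≤ 2·max(|d_K|^{L(n)}, D_θ)`.
Unconditional.  [LagariasMontgomeryOdlyzko1979, Thm 1.1] [NeukirchANT1999, I (8.3)]
[SerreLocalFields1979, IV §1].  0 sorries, standard axioms.
-/

noncomputable section

open scoped NumberField Polynomial
open Polynomial NumberField Ideal Finset
open Literature.NumberTheory.NumberFields Literature.NumberTheory.LFunctions.NumberField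

namespace Summit.QuantumAdvantage.QuantumAdvantage.Theorems.DegreeOnePrimesEscape

/-- **Unramified in `K` ⇒ unramified in the Galois closure**: if `N/ℚ` is Galois and the embedded
copies of `K` separate `Gal(N/ℚ)` (e.g. `N` a Galois closure of `K`), then every prime `p ∤ d_K`
satisfies `p ∤ d_N` (`|d_N| ∣ ∏_ι |d_{ιK}|^{[N:ιK]} = |d_K|^{Σ}`).
[cite: SerreLocalFields1979, Ch. IV §1 Prop. 4 and Cor.] -/
theorem not_dvd_discr_of_separating (K : Type) [Field K] [NumberField K] (N : Type) [Field N]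
    [NumberField N] [IsGalois ℚ N]
    (hsep : ∀ s : N ≃ₐ[ℚ] N, s ≠ 1 → ∃ f : K →ₐ[ℚ] N, s ∉ f.fieldRange.fixingSubgroup)
    {p : ℕ} (hp : p.Prime) (hpK : ¬ ((p : ℤ) ∣ NumberField.discr K)) :
    ¬ ((p : ℤ) ∣ NumberField.discr N) := by
  classical
  have hdvd := natAbs_discr_dvd_prod_pow_of_isGalois N Finset.univ
    (fun f : K →ₐ[ℚ] N => f.fieldRange) (fun s hs => by
      obtain ⟨f, hf⟩ := hsep s hs
      exact ⟨f, Finset.mem_univ _, hf⟩)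
  rw [Finset.prod_congr rfl fun f _ => by rw [natAbs_discr_fieldRange K N f],
    Finset.prod_pow_eq_pow_sum] at hdvd
  intro hpN
  have h1 : p ∣ (NumberField.discr N).natAbs := Int.natCast_dvd.mp hpN
  have h3 : p ∣ (NumberField.discr K).natAbs := hp.dvd_of_dvd_pow (h1.trans hdvd)
  exact hpK (Int.natCast_dvd.mpr h3)

/-- **Galois-closure data with transfer of unramifiedness** (`exists_galoisClosure_perm` plus
`not_dvd_discr_of_separating`): for a number field `K` of degree `n`, a Galois `N ⊇ ι(K)` with
`[N:ℚ] ≤ n!`, `|d_N| ≤ |d_K|^{[N:ℚ]}`, every `p ∤ d_K` unramified in `N`, and `ψ : Gal(N/ℚ) → S_n` with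
`Gal(N/ιK) = Stab_ψ(0)`. [folklore] -/
theorem exists_galoisClosure_perm_unramified (n : ℕ) [NeZero n] (K : Type) [Field K] [NumberField K]
    (hK : Module.finrank ℚ K = n) :
    ∃ (N : Type) (_ : Field N) (_ : NumberField N), IsGalois ℚ N ∧
      Module.finrank ℚ N ≤ n.factorial ∧
      (NumberField.discr N).natAbs ≤ (NumberField.discr K).natAbs ^ Module.finrank ℚ N ∧
      (∀ p : ℕ, p.Prime → ¬ ((p : ℤ) ∣ NumberField.discr K) → ¬ ((p : ℤ) ∣ NumberField.discr N)) ∧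
      ∃ (f : K →ₐ[ℚ] N) (ψ : (N ≃ₐ[ℚ] N) →* Equiv.Perm (Fin n)),
        ∀ g : N ≃ₐ[ℚ] N, g ∈ f.fieldRange.fixingSubgroup ↔ ψ g 0 = 0 := by
  classical
  obtain ⟨N, _, _, hGal, hdeg, -, ⟨f⟩, hsep, hdisc⟩ := exists_galoisClosure K
  haveI := hGal
  refine ⟨N, inferInstance, inferInstance, hGal, hK ▸ hdeg, hdisc,
    fun p hp hpK => not_dvd_discr_of_separating K N hsep hp hpK, f, ?_⟩
  set H : Subgroup (N ≃ₐ[ℚ] N) := f.fieldRange.fixingSubgroup with hH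
  have hKf : Module.finrank ℚ f.fieldRange = n := by
    rw [← hK]; exact (f.equivFieldRange.toLinearEquiv.finrank_eq).symm
  have hind : H.index = n := (index_fixingSubgroup_eq_finrank f.fieldRange).trans hKf
  have hcard : Fintype.card ((N ≃ₐ[ℚ] N) ⧸ H) = n := by
    rw [← Nat.card_eq_fintype_card]; exact hind
  let e₁ : ((N ≃ₐ[ℚ] N) ⧸ H) ≃ Fin n := Fintype.equivFinOfCardEq hcard
  let e : ((N ≃ₐ[ℚ] N) ⧸ H) ≃ Fin n :=
    e₁.trans (Equiv.swap (e₁ ((1 : N ≃ₐ[ℚ] N) : (N ≃ₐ[ℚ] N) ⧸ H)) 0)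
  have he : e ((1 : N ≃ₐ[ℚ] N) : (N ≃ₐ[ℚ] N) ⧸ H) = 0 := by simp [e, Equiv.swap_apply_left]
  let ψ : (N ≃ₐ[ℚ] N) →* Equiv.Perm (Fin n) :=
    e.permCongrHom.toMonoidHom.comp (MulAction.toPermHom (N ≃ₐ[ℚ] N) ((N ≃ₐ[ℚ] N) ⧸ H))
  refine ⟨ψ, fun g => ?_⟩
  have h1 : ψ g 0 = e (g • e.symm 0) := rfl
  have h2 : e.symm 0 = ((1 : N ≃ₐ[ℚ] N) : (N ≃ₐ[ℚ] N) ⧸ H) := by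
    rw [← he, Equiv.symm_apply_apply]
  rw [h1, h2, ← he, e.apply_eq_iff_eq, MulAction.Quotient.smul_coe, smul_eq_mul, mul_one,
    QuotientGroup.eq, mul_one, inv_mem_iff]

/-- **Every factorisation pattern recurs below `2·max(|d_K|^L, D_θ)`** (see the module docstring): for
`n > 1` there is `L = L(n) > 0` such that for every number field `K` of degree `n`, every `θ ∈ 𝓞_K`
with `K = ℚ(θ)`, and every prime `ℓ` with `ℓ ∤ d_K`, `ℓ ∤ e_θ`, there is a prime
`p ≤ 2·max(|d_K|^L, D_θ)` (`D_θ = N((f'(θ)))`, `f = minpoly ℤ θ`) with `p ∤ d_K`, `p ∤ e_θ`, at which the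
degrees of the distinct monic irreducible factors of `f mod p` are those of `f mod ℓ`.  Unconditional.
[cite: LagariasMontgomeryOdlyzko1979, Theorem 1.1] [cite: NeukirchANT1999, Ch. I Prop. (8.3)] -/
theorem exists_prime_factorDegrees_eq_of_prime (n : ℕ) [NeZero n] (hn : 1 < n) :
    ∃ L : ℝ, 0 < L ∧ ∀ (K : Type) [Field K] [NumberField K], Module.finrank ℚ K = n →
      ∀ θ : 𝓞 K, Algebra.adjoin ℚ {(θ : K)} = ⊤ →
      ∀ (ℓ : ℕ) [Fact ℓ.Prime], ¬ ((ℓ : ℤ) ∣ NumberField.discr K) → ¬ ℓ ∣ RingOfIntegers.exponent θ →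
        ∃ (p : ℕ) (_ : Fact p.Prime),
          (p : ℝ) ≤ 2 * max (((NumberField.discr K).natAbs : ℝ) ^ L)
            (Ideal.absNorm (span {aeval θ (derivative (minpoly ℤ θ))}) : ℝ) ∧
          ¬ ((p : ℤ) ∣ NumberField.discr K) ∧ ¬ p ∣ RingOfIntegers.exponent θ ∧
          (RingOfIntegers.monicFactorsMod θ p).val.map Polynomial.natDegree =
            (RingOfIntegers.monicFactorsMod θ ℓ).val.map Polynomial.natDegree := by
  obtain ⟨L, hL, h⟩ := exists_prime_factorDegrees_eq_cycleType_le n hn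
  refine ⟨L, hL, fun K _ _ hK θ hgen ℓ hℓF hℓK hℓe => ?_⟩
  have hℓ : ℓ.Prime := hℓF.out
  obtain ⟨N, _, _, hGal, hNle, hdN, hunr, ι, ψ, hstab⟩ := exists_galoisClosure_perm_unramified n K hK
  haveI := hGal
  have hℓN : ¬ ((ℓ : ℤ) ∣ NumberField.discr N) := hunr ℓ hℓ hℓK
  obtain ⟨Q, hQ, hQℓ, ⟨φ, hφ⟩, hI⟩ := exists_isArithFrobAt_of_not_dvd_discr (N := N) hℓ hℓN
  haveI := hQ
  haveI := hQℓ
  have hKι : Module.finrank ℚ ι.fieldRange = n := by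
    rw [← hK]; exact (ι.equivFieldRange.toLinearEquiv.finrank_eq).symm
  -- the pattern at `ℓ` is the full cycle type of `ψ φ`
  have hpat : (RingOfIntegers.monicFactorsMod θ ℓ).val.map Polynomial.natDegree =
      (ψ φ).cycleType + Multiset.replicate (n - (ψ φ).support.card) 1 := by
    rw [← splittingType_eq_map_natDegree_monicFactorsMod hℓe,
      ArithmeticallyEquivalent.of_algEquiv ι.equivFieldRange ℓ hℓ]
    exact splittingType_eq_fullCycleType_of_hom ι.fieldRange ψ hstab hKι hℓ Q hφ hI
  obtain ⟨p, hpF, hple, hnd, hexp, hT⟩ := h K hK N ι hNle hdN ψ hstab θ hgen φ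
  exact ⟨p, hpF, hple, hnd, hexp, hT.trans hpat.symm⟩

/-- **Distinct roots and the splitting type**: for `p ∤ e_θ` the number of distinct roots of
`minpoly ℤ θ` modulo `p` is the number of primes of `K` above `p` of residue degree one, i.e. the
multiplicity of `1` in `splittingType K p`. [cite: NeukirchANT1999, Ch. I Prop. (8.3)] -/
theorem card_roots_toFinset_eq_count_one_splittingType {K : Type*} [Field K] [NumberField K] {θ : 𝓞 K}
    {p : ℕ} [Fact p.Prime] (hθ : ¬ p ∣ RingOfIntegers.exponent θ) :
    ((minpoly ℤ θ).map (Int.castRingHom (ZMod p))).roots.toFinset.card = (splittingType K p).count 1 := by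
  classical
  have hg : (minpoly ℤ θ).map (Int.castRingHom (ZMod p)) ≠ 0 :=
    Polynomial.map_monic_ne_zero (minpoly.monic θ.isIntegral)
  rw [card_roots_toFinset_eq_card_filter hg, splittingType_eq_map_natDegree_monicFactorsMod hθ,
    Multiset.count_map]
  rw [← Finset.filter_val, Finset.card_val]
  congr 1
  ext Q
  simp only [Finset.mem_filter, RingOfIntegers.monicFactorsMod, eq_comm]

/-- **X. Li's least non-split prime in polynomial language (monogenic case)**: for `n > 1` there is
`L = L(n) > 0` such that for every number field `K` of degree `n` and every `θ` with `𝓞_K = ℤ[θ]`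
(`e_θ = 1`), there is a prime `p ≤ |d_K|^L`, `p ∤ d_K`, modulo which `minpoly ℤ θ` has FEWER than `n`
distinct roots (i.e. does not split into distinct linear factors).  Unconditional.
[cite: LagariasMontgomeryOdlyzko1979, Theorem 1.1] [cite: NeukirchANT1999, Ch. I Prop. (8.3)] -/
theorem exists_prime_card_roots_lt_le_of_exponent_eq_one (n : ℕ) (hn : 1 < n) :
    ∃ L : ℝ, 0 < L ∧ ∀ (K : Type) [Field K] [NumberField K], Module.finrank ℚ K = n →
      ∀ θ : 𝓞 K, RingOfIntegers.exponent θ = 1 →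
        ∃ (p : ℕ) (_ : Fact p.Prime), (p : ℝ) ≤ ((NumberField.discr K).natAbs : ℝ) ^ L ∧
          ¬ ((p : ℤ) ∣ NumberField.discr K) ∧
          ((minpoly ℤ θ).map (Int.castRingHom (ZMod p))).roots.toFinset.card < n := by
  obtain ⟨L, hL, h⟩ := exists_nonsplitPrime_le_of_finrank n hn
  refine ⟨L, hL, fun K _ _ hK θ hθ => ?_⟩
  obtain ⟨p, hp, hple, hnd, hcount⟩ := h K hK
  haveI : Fact p.Prime := ⟨hp⟩
  have hθp : ¬ p ∣ RingOfIntegers.exponent θ := by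
    rw [hθ, Nat.dvd_one]; exact hp.one_lt.ne'
  exact ⟨p, inferInstance, hple, hnd, by rwa [card_roots_toFinset_eq_count_one_splittingType hθp]⟩

/-- **As many distinct roots as the degree ⇒ product of distinct linear factors**: a non-zero
polynomial `g` over a field with at least `deg g` distinct roots splits and is separable. [folklore] -/
theorem splits_and_separable_of_natDegree_le_card_roots_toFinset {F : Type*} [Field F] [DecidableEq F]
    {g : F[X]} (hg : g ≠ 0) (h : g.natDegree ≤ g.roots.toFinset.card) :
    g.Splits ∧ g.Separable := by
  have h1 : g.roots.toFinset.card ≤ g.roots.card := Multiset.toFinset_card_le _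
  have h2 : g.roots.card ≤ g.natDegree := Polynomial.card_roots' g
  have hsplits : g.Splits := Polynomial.splits_iff_card_roots.mpr (le_antisymm h2 (h.trans h1))
  have hnodup : g.roots.Nodup :=
    Multiset.toFinset_card_eq_card_iff_nodup.mp (le_antisymm h1 (h2.trans h))
  exact ⟨hsplits, (Polynomial.nodup_roots_iff_of_splits hg hsplits).mp hnodup⟩

/-- `deg (f mod p) = deg f ≤ [K:ℚ]` for `f = minpoly ℤ θ`, `θ ∈ 𝓞_K` (`minpoly ℚ θ = f` over `ℚ`,
`minpoly.isIntegrallyClosed_eq_field_fractions`). [folklore] -/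
theorem natDegree_map_minpoly_le_finrank {K : Type*} [Field K] [NumberField K] (θ : 𝓞 K) (p : ℕ)
    [Fact p.Prime] :
    ((minpoly ℤ θ).map (Int.castRingHom (ZMod p))).natDegree ≤ Module.finrank ℚ K := by
  rw [(minpoly.monic θ.isIntegral).natDegree_map]
  have h : (minpoly ℚ (θ : K)).natDegree = (minpoly ℤ θ).natDegree := by
    rw [show (θ : K) = algebraMap (𝓞 K) K θ from rfl,
      minpoly.isIntegrallyClosed_eq_field_fractions ℚ K θ.isIntegral,
      (minpoly.monic θ.isIntegral).natDegree_map]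
  rw [← h]
  exact minpoly.natDegree_le (θ : K)

/-- **The least prime modulo which an irreducible integer polynomial splits into DISTINCT LINEAR
FACTORS** (`Splits ∧ Separable` form of `exists_prime_card_roots_eq_le`): for `n > 1` there is
`L = L(n) > 0` such that for every number field `K` of degree `n` and every `θ ∈ 𝓞_K` with `K = ℚ(θ)`
there is a prime `p ≤ 2·max(|d_K|^L, N((f'(θ))))`, `f = minpoly ℤ θ`, with `p ∤ d_K`, `p ∤ e_θ`, such
that `f mod p` splits completely over `𝔽_p` and is separable.  Unconditional, GRH-free.
[cite: LagariasMontgomeryOdlyzko1979, Theorem 1.1 and Corollary 1.3] [cite: NeukirchANT1999, Ch. I Prop. (8.3)] -/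
theorem exists_prime_splits_separable_le (n : ℕ) [NeZero n] (hn : 1 < n) :
    ∃ L : ℝ, 0 < L ∧ ∀ (K : Type) [Field K] [NumberField K], Module.finrank ℚ K = n →
      ∀ θ : 𝓞 K, Algebra.adjoin ℚ {(θ : K)} = ⊤ →
        ∃ (p : ℕ) (_ : Fact p.Prime),
          (p : ℝ) ≤ 2 * max (((NumberField.discr K).natAbs : ℝ) ^ L)
            (Ideal.absNorm (span {aeval θ (derivative (minpoly ℤ θ))}) : ℝ) ∧
          ¬ ((p : ℤ) ∣ NumberField.discr K) ∧ ¬ p ∣ RingOfIntegers.exponent θ ∧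
          ((minpoly ℤ θ).map (Int.castRingHom (ZMod p))).Splits ∧
          ((minpoly ℤ θ).map (Int.castRingHom (ZMod p))).Separable := by
  classical
  obtain ⟨L, hL, h⟩ := exists_prime_card_roots_eq_le n hn
  refine ⟨L, hL, fun K _ _ hK θ hgen => ?_⟩
  obtain ⟨p, hpF, hple, hnd, hexp, hcard⟩ := h K hK θ hgen
  have hg : (minpoly ℤ θ).map (Int.castRingHom (ZMod p)) ≠ 0 :=
    Polynomial.map_monic_ne_zero (minpoly.monic θ.isIntegral)
  have hdeg : ((minpoly ℤ θ).map (Int.castRingHom (ZMod p))).natDegree ≤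
      ((minpoly ℤ θ).map (Int.castRingHom (ZMod p))).roots.toFinset.card := by
    rw [hcard, ← hK]; exact natDegree_map_minpoly_le_finrank θ p
  exact ⟨p, hpF, hple, hnd, hexp, splits_and_separable_of_natDegree_le_card_roots_toFinset hg hdeg⟩

end Summit.QuantumAdvantage.QuantumAdvantage.Theorems.DegreeOnePrimesEscape

end
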